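import Summits.NavierStokesRegularity.NavierStokesRegularity.Theorems.SqueezeCycleExtremalElementExistsRegularity
import Literature.Analysis.FluidPDE.TypeIRateOseenMildRepresentative
import Literature.Analysis.FluidPDE.KNSSLiouville
import Literature.Analysis.FluidPDE.LocalTypeICongr
import Literature.Analysis.FluidPDE.ScalingUniformRecurrence
import Literature.Analysis.FluidPDE.SelfSimilarLiouville
import HarnessLib

/-!
# Crux `RecurrentLiouville` (stmt-NavierStokesRegularity-1589), line `Sketch` — stub
# `stub_satClosingEndpoints`: the three closing endpoints of the Type-I DSS wall

Theorems-only file (no definitions, no named facts).  The crux says that uniformly recurrent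
Type-I suitable weak ancient Navier–Stokes solutions of the Albritton–Barker class are regular at
the space–time origin.  This file records the three "closing endpoints" at which the (rotated)
Type-I discretely self-similar Liouville wall `RotatedTypeIDSSLiouville c R` /
`TypeIDSSLiouville λ` (Bradshaw–Tsai, Open Problem 5.1; Chae–Wolf, Def. 1.1 for rotated DSS
fields) closes a branch of the argument:

* (a) ACCUMULATION KILL.  If rotated-DSS ancient mild fields with the apex bound
  `‖w(t, x)‖ ≤ C₀/(‖x‖ + √(−t))` accumulate in `L³(K)`, for every compact `K ⊆ {t ≤ 0} × ℝ³`, at a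
  field `u` which is jointly measurable on the open slab, then `u` is regular at the origin: every
  approximant is killed by the wall slice by slice, hence a.e. on the slab (Fubini,
  `ae_eq_zero_slab_of_ae_slice`), hence a.e. on `K = [−1, 0] × B̄(0, 1)` (the hyperplane `{t = 0}`
  is null, `ae_restrict_of_ae_restrict_Iio_prod_univ`); so `‖u‖_{L³(K)} ≤ ε` for every `ε > 0`,
  `u = 0` a.e. on `Q(0, 1) ⊆ K`, and `‖u‖_{L^∞(Q(0,1))} = 0 ≠ ∞`.
* (b) RELATIVE-PERIODIC KILL.  A rotated-DSS ancient mild field with the apex bound is regular at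
  the origin under the wall (the wall, Fubini, `Q(0, 1) ⊆` slab).
* (c) THE PERIODIC RUNG INSIDE THE CLASS.  An a.e. `λ`-DSS (`λ > 1`) suitable weak solution on the
  slab with a weak gradient, `𝐈(ℝ³ × ℝ₋) < ∞` and the apex bound is regular at the origin if
  `TypeIDSSLiouville λ` holds.  Proof: the apex bound gives the rate `C/√(−t)`, so the slab form of
  Albritton–Barker 2019, Thm 1.1 (`exists_oseenMild_repr_of_typeIBound_lt_top`) supplies a
  continuous Oseen-mild representative `v`, a Type-I ancient mild field by KNSS 2009, Prop. 4.1
  (`isTypeIAncientMild_of_continuous_oseenMild`), hence an ancient mild solution in the duality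
  sense.  A.e. `λ`-self-similarity of `u` becomes pointwise `λ`-self-similarity of the continuous
  `v` on the open slab (transport along the parabolic dilation, `ae_restrict_preimage_stAffine`,
  and `Measure.eqOn_open_of_ae_eq`), and likewise the apex bound passes to `v` everywhere on the
  slab.  Normalising `v` to `0` at times `t ≥ 0` (the mild, measurability and decay clauses only see
  `t < 0`) produces an exactly `λ`-DSS field to which the wall applies; its slices vanish a.e.,
  hence identically (continuity), so `u = 0` a.e. on the slab and the origin is regular.

## References

* Z. Bradshaw, T.-P. Tsai, Comm. PDE 42 (2017) = arXiv:1610.05680, §5, Open Problem 5.1.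
  [cite: BradshawTsai2017CPDE, §5 Open Problem 5.1]
* D. Chae, J. Wolf, Comm. PDE 42 (2017) = arXiv:1610.09464, Def. 1.1. [cite: ChaeWolf2017, Def. 1.1]
* D. Albritton, T. Barker, J. Math. Fluid Mech. 21 (2019) = arXiv:1811.00502, Thm 1.1.
  [cite: AlbrittonBarker2019, Thm 1.1]
* G. Koch, N. Nadirashvili, G. Seregin, V. Šverák, Acta Math. 203 (2009) = arXiv:0709.3599,
  Prop. 4.1. [cite: KochNadirashviliSereginSverak2009, Prop. 4.1]
-/

noncomputable section

-- the sub-problem namespace repeats the summit name (D-0017 layout `Summit.<S>.<P>.Theorems`)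
set_option linter.dupNamespace false

namespace Summit.NavierStokesRegularity.NavierStokesRegularity.Theorems

open MeasureTheory Set Function Filter Topology TopologicalSpace Metric
open Literature.Analysis.FluidPDE
open scoped NNReal ENNReal RealInnerProductSpace Laplacian ContDiff

/-- Local notation for physical space. -/
local notation "E3" => EuclideanSpace ℝ (Fin 3)

/-- A field vanishing a.e. on the unit backward parabolic ball `Q(0, 1)` is not singular at the
origin: `‖u‖_{L^∞(Q(0,1))} = 0 ≠ ∞`. [folklore] -/
private theorem satCE_not_singular_of_ae_zero_ball {u : ℝ → E3 → E3}
    (hQ : uncurry u =ᵐ[volume.restrict (parabolicCylinder 1 (0 : ℝ × E3))] 0) :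
    ¬ IsBackwardSingularPoint u 0 := by
  intro hsing
  have h0 : eLpNorm (uncurry u) ∞ (volume.restrict (parabolicCylinder 1 (0 : ℝ × E3))) = 0 := by
    rw [eLpNorm_congr_ae hQ, eLpNorm_zero]
  have htop := hsing 1 one_pos
  rw [h0] at htop
  exact ENNReal.zero_ne_top htop

/-- A field vanishing a.e. on the open backward slab `ℝ₋ × ℝ³ ⊇ Q(0, 1)` is not singular at the
origin. [folklore] -/
private theorem satCE_not_singular_of_ae_zero_slab {u : ℝ → E3 → E3}
    (h : ∀ᵐ z ∂(volume.restrict (Iio (0 : ℝ) ×ˢ (univ : Set E3))), uncurry u z = (0 : ℝ × E3 → E3) z) :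
    ¬ IsBackwardSingularPoint u 0 :=
  satCE_not_singular_of_ae_zero_ball
    (ae_restrict_of_ae_restrict_of_subset (parabolicCylinder_origin_subset_slab 1) h)

/-- **The wall kills jointly.**  If the rotated Type-I DSS wall holds for `(c, R)` and `w` is an
ancient mild rotated `(c, R)`-DSS field (`1 < c`) with measurable slices, jointly measurable on the
open slab, with the apex bound, then `w = 0` a.e. on the open slab (the wall slice by slice, then
Fubini `ae_eq_zero_slab_of_ae_slice`). [cite: BradshawTsai2017CPDE, §5 Open Problem 5.1] -/
private theorem satCE_ae_zero_slab_of_wall {c : ℝ} {R : E3 ≃ₗᵢ[ℝ] E3} {w : ℝ → E3 → E3} {C₀ : ℝ}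
    (hwall : RotatedTypeIDSSLiouville c R) (hc : 1 < c) (hmild : IsAncientMildSolution 1 w)
    (hslice : ∀ t < 0, AEStronglyMeasurable (w t) volume)
    (hmeas : AEStronglyMeasurable (uncurry w) (volume.restrict (Iio (0 : ℝ) ×ˢ univ)))
    (hdss : IsRotatedDSS c R w) (hdec : HasTypeIDecay C₀ w) :
    ∀ᵐ z ∂(volume.restrict (Iio (0 : ℝ) ×ˢ (univ : Set E3))), w z.1 z.2 = 0 := by
  have hw0 : ∀ t < 0, w t =ᵐ[volume] 0 := hwall hc w hmild hslice hdss ⟨C₀, hdec⟩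
  exact ae_eq_zero_slab_of_ae_slice hmeas
    ((ae_restrict_mem measurableSet_Iio).mono fun t ht => hw0 t ht)

/-- **(a) ACCUMULATION KILL.**  If rotated-DSS ancient mild fields with the apex bound accumulate
in `L³(K)`, for every compact `K ⊆ {t ≤ 0} × ℝ³`, at a field `u` jointly measurable on the open
slab, then under the rotated Type-I DSS wall `u` is regular at the origin: each approximant
vanishes a.e. on the slab, hence a.e. on `K = [−1, 0] × B̄(0, 1)` (`{t = 0}` is null), so
`‖u‖_{L³(K)} ≤ ε` for all `ε > 0`, `u = 0` a.e. on `Q(0, 1) ⊆ K`.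
[cite: BradshawTsai2017CPDE, §5 Open Problem 5.1] -/
private theorem satCE_accumulation :
    ∀ (u : ℝ → EuclideanSpace ℝ (Fin 3) → EuclideanSpace ℝ (Fin 3)),
      AEStronglyMeasurable (uncurry u) (volume.restrict (Iio (0 : ℝ) ×ˢ univ)) →
      (∀ ε : ℝ, 0 < ε → ∀ K : Set (ℝ × EuclideanSpace ℝ (Fin 3)), IsCompact K →
        K ⊆ Iic (0 : ℝ) ×ˢ univ →
        ∃ (c : ℝ) (R : EuclideanSpace ℝ (Fin 3) ≃ₗᵢ[ℝ] EuclideanSpace ℝ (Fin 3))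
          (w : ℝ → EuclideanSpace ℝ (Fin 3) → EuclideanSpace ℝ (Fin 3)) (C₀ : ℝ), 1 < c ∧
          IsAncientMildSolution 1 w ∧ (∀ t < 0, AEStronglyMeasurable (w t) volume) ∧
          AEStronglyMeasurable (uncurry w) (volume.restrict (Iio (0 : ℝ) ×ˢ univ)) ∧
          IsRotatedDSS c R w ∧ HasTypeIDecay C₀ w ∧
          eLpNorm (fun z : ℝ × EuclideanSpace ℝ (Fin 3) => w z.1 z.2 - u z.1 z.2) 3
            (volume.restrict K) ≤ ENNReal.ofReal ε) →
      (∀ (c : ℝ) (R : EuclideanSpace ℝ (Fin 3) ≃ₗᵢ[ℝ] EuclideanSpace ℝ (Fin 3)),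
        RotatedTypeIDSSLiouville c R) →
      ¬ IsBackwardSingularPoint u 0 := by
  intro u hmeas hacc hwall
  -- the compact test set `K = [−1, 0] × B̄(0, 1) ⊇ Q(0, 1)` in the closed lower half-space
  set K : Set (ℝ × E3) := Icc (-1 : ℝ) 0 ×ˢ closedBall (0 : E3) 1 with hK
  have hKc : IsCompact K := isCompact_Icc.prod (isCompact_closedBall _ _)
  have hKH : K ⊆ Iic (0 : ℝ) ×ˢ univ := prod_mono Icc_subset_Iic_self (subset_univ _)
  have hQK : parabolicCylinder 1 (0 : ℝ × E3) ⊆ K := by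
    intro z hz
    rw [mem_parabolicCylinder] at hz
    obtain ⟨⟨h1, h2⟩, h3⟩ := hz
    simp only [Prod.fst_zero, Prod.snd_zero, one_pow, zero_sub] at h1 h2 h3
    exact mem_prod.2 ⟨mem_Icc.2 ⟨h1.le, h2.le⟩, mem_closedBall.2 h3.le⟩
  -- `‖u‖_{L³(K)} ≤ ε` for every `ε > 0`
  have hKε : ∀ ε : ℝ, 0 < ε → eLpNorm (uncurry u) 3 (volume.restrict K) ≤ ENNReal.ofReal ε := by
    intro ε hε
    obtain ⟨c, R, w, C₀, hc, hmild, hslice, hwmeas, hdss, hdec, hε'⟩ := hacc ε hε K hKc hKH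
    have hwK : ∀ᵐ z ∂(volume.restrict K), w z.1 z.2 = 0 :=
      ae_restrict_of_ae_restrict_Iio_prod_univ
        (satCE_ae_zero_slab_of_wall (hwall c R) hc hmild hslice hwmeas hdss hdec) hKH
    have hcongr : (fun z : ℝ × E3 => w z.1 z.2 - u z.1 z.2) =ᵐ[volume.restrict K] (-uncurry u) := by
      filter_upwards [hwK] with z hz
      rw [Pi.neg_apply, hz, zero_sub]
      rfl
    rw [← eLpNorm_neg (uncurry u), ← eLpNorm_congr_ae hcongr]
    exact hε'
  -- hence `‖u‖_{L³(K)} = 0` and `u = 0` a.e. on `Q(0, 1)`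
  have hK0 : eLpNorm (uncurry u) 3 (volume.restrict K) = 0 := by
    refine le_antisymm (ENNReal.le_of_forall_pos_le_add fun ε hε _ => ?_) zero_le
    rw [zero_add, ← ENNReal.ofReal_coe_nnreal]
    exact hKε ε (NNReal.coe_pos.2 hε)
  have hQ0 : eLpNorm (uncurry u) 3 (volume.restrict (parabolicCylinder 1 (0 : ℝ × E3))) = 0 :=
    le_antisymm ((eLpNorm_mono_measure _ (Measure.restrict_mono hQK le_rfl)).trans hK0.le)
      zero_le
  have hmeasQ : AEStronglyMeasurable (uncurry u)
      (volume.restrict (parabolicCylinder 1 (0 : ℝ × E3))) :=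
    hmeas.mono_measure (Measure.restrict_mono (parabolicCylinder_origin_subset_slab 1) le_rfl)
  exact satCE_not_singular_of_ae_zero_ball ((eLpNorm_eq_zero_iff hmeasQ (by norm_num)).1 hQ0)

/-- **(b) RELATIVE-PERIODIC KILL.**  A rotated-DSS (`1 < c`) ancient mild field with measurable
slices, jointly measurable on the open slab, with the apex bound, is regular at the origin under
the rotated Type-I DSS wall (it vanishes a.e. on the slab, which contains `Q(0, 1)`).
[cite: BradshawTsai2017CPDE, §5 Open Problem 5.1] [cite: ChaeWolf2017, Def. 1.1] -/
private theorem satCE_relPeriodic :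
    ∀ (u : ℝ → EuclideanSpace ℝ (Fin 3) → EuclideanSpace ℝ (Fin 3)),
      IsAncientMildSolution 1 u → (∀ t < 0, AEStronglyMeasurable (u t) volume) →
      AEStronglyMeasurable (uncurry u) (volume.restrict (Iio (0 : ℝ) ×ˢ univ)) →
      (∃ C₀ : ℝ, HasTypeIDecay C₀ u) →
      (∃ (c : ℝ) (R : EuclideanSpace ℝ (Fin 3) ≃ₗᵢ[ℝ] EuclideanSpace ℝ (Fin 3)), 1 < c ∧ IsRotatedDSS c R u) →
      (∀ (c : ℝ) (R : EuclideanSpace ℝ (Fin 3) ≃ₗᵢ[ℝ] EuclideanSpace ℝ (Fin 3)),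
        RotatedTypeIDSSLiouville c R) →
      ¬ IsBackwardSingularPoint u 0 := by
  intro u hmild hslice hmeas hdec hdss hwall
  obtain ⟨C₀, hC₀⟩ := hdec
  obtain ⟨c, R, hc, hcR⟩ := hdss
  exact satCE_not_singular_of_ae_zero_slab
    ((satCE_ae_zero_slab_of_wall (hwall c R) hc hmild hslice hmeas hcR hC₀).mono fun z hz => hz)

/-- **A.e. discrete self-similarity of a continuous representative is pointwise.**  If `w = v` a.e.
on the open backward slab, `v` is continuous there and `w_c = w` a.e. on the slab (`c > 0`), then
`c v(c² t, c x) = v(t, x)` for all `t < 0`, `x`: the parabolic dilation `Φ_c = stAffine (c²) c 0 0`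
is non-singular and preserves the slab (`ae_restrict_preimage_stAffine`), and two continuous
functions a.e. equal on an open set agree there (`Measure.eqOn_open_of_ae_eq`). [folklore] -/
private theorem satCE_dss_pointwise {w v : ℝ → E3 → E3}
    (hae : ∀ᵐ z ∂(volume.restrict (Iio (0 : ℝ) ×ˢ (univ : Set E3))), uncurry w z = uncurry v z)
    (hcont : ContinuousOn (uncurry v) (Iio 0 ×ˢ univ)) {c : ℝ} (hc : 0 < c)
    (hss : ∀ᵐ z ∂(volume.restrict (Iio (0 : ℝ) ×ˢ (univ : Set E3))),
      nsRescale c w z.1 z.2 = w z.1 z.2)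
    {t : ℝ} (ht : t < 0) (x : E3) :
    c • v (c ^ 2 * t) (c • x) = v t x := by
  -- adapted from `rlSelfSimilarRepr_pointwise` (SqueezeCycleRecurrentLiouvilleSelfSimilarRepr)
  have hc2 : 0 < c ^ 2 := by positivity
  -- `w ∘ Φ_c = v ∘ Φ_c` a.e. on `Φ_c⁻¹ {t < 0} = {t < 0}`
  have hΦae := ae_restrict_preimage_stAffine hc2 hc 0 (0 : E3) hae
  rw [stAffine_sq_preimage_Iio_prod_univ hc.ne'] at hΦae
  -- hence `c • v ∘ Φ_c = v` a.e. on the slab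
  have hF : (fun z : ℝ × E3 => c • v (c ^ 2 * z.1) (c • z.2)) =ᵐ[
      volume.restrict (Iio (0 : ℝ) ×ˢ (univ : Set E3))] uncurry v := by
    filter_upwards [hae, hΦae, hss] with z hz hΦz hσz
    simp only [uncurry, stAffine_fst, stAffine_snd, zero_add] at hz hΦz ⊢
    rw [nsRescale_apply] at hσz
    rw [← hΦz, hσz, hz]
  -- both sides are continuous on the open slab
  have hmaps : MapsTo (stAffine (c ^ 2) c 0 (0 : E3)) (Iio (0 : ℝ) ×ˢ (univ : Set E3))
      (Iio 0 ×ˢ univ) := by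
    intro z hz
    simp only [mem_prod, mem_Iio, mem_univ, and_true, stAffine_fst, zero_add] at hz ⊢
    exact mul_neg_of_pos_of_neg hc2 hz
  have hFc : ContinuousOn (fun z : ℝ × E3 => c • v (c ^ 2 * z.1) (c • z.2))
      (Iio (0 : ℝ) ×ˢ (univ : Set E3)) := by
    refine ((hcont.comp (continuous_stAffine (c ^ 2) c 0 (0 : E3)).continuousOn
      hmaps).const_smul c).congr fun z _ => ?_
    simp only [Pi.smul_apply, comp_apply, uncurry, stAffine_fst, stAffine_snd, zero_add]
  have hEq := Measure.eqOn_open_of_ae_eq hF (isOpen_Iio.prod isOpen_univ) hFc hcont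
  have h := hEq (x := (t, x)) ⟨ht, mem_univ _⟩
  simpa using h

/-- **The apex bound passes to a continuous representative.**  If `u = v` a.e. on the open slab,
`v` is continuous there and `‖u(t, x)‖ ≤ C/(‖x‖ + √(−t))` for all `t < 0`, `x`, then the same bound
holds for `v` everywhere on the slab: the continuous excess `max (‖v‖ − C/(‖x‖ + √(−t))) 0`
vanishes a.e. on the open slab, hence everywhere (`Measure.eqOn_open_of_ae_eq`). [folklore] -/
private theorem satCE_decay_repr {u v : ℝ → E3 → E3} {C : ℝ}
    (hae : ∀ᵐ z ∂(volume.restrict (Iio (0 : ℝ) ×ˢ (univ : Set E3))), uncurry u z = uncurry v z)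
    (hcont : ContinuousOn (uncurry v) (Iio 0 ×ˢ univ)) (hdec : HasTypeIDecay C u)
    {t : ℝ} (ht : t < 0) (x : E3) : ‖v t x‖ ≤ C / (‖x‖ + Real.sqrt (-t)) := by
  have hBc : ContinuousOn (fun z : ℝ × E3 => C / (‖z.2‖ + Real.sqrt (-z.1)))
      (Iio (0 : ℝ) ×ˢ (univ : Set E3)) := by
    refine continuousOn_const.div
      (continuous_snd.norm.add continuous_fst.neg.sqrt).continuousOn fun z hz => ?_
    have hz1 : z.1 < 0 := hz.1
    exact (add_pos_of_nonneg_of_pos (norm_nonneg _) (Real.sqrt_pos.2 (neg_pos.2 hz1))).ne'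
  have hfc : ContinuousOn
      (fun z : ℝ × E3 => max (‖uncurry v z‖ - C / (‖z.2‖ + Real.sqrt (-z.1))) 0)
      (Iio (0 : ℝ) ×ˢ (univ : Set E3)) :=
    (hcont.norm.sub hBc).sup continuousOn_const
  have hf0 : (fun z : ℝ × E3 => max (‖uncurry v z‖ - C / (‖z.2‖ + Real.sqrt (-z.1))) 0) =ᵐ[
      volume.restrict (Iio (0 : ℝ) ×ˢ (univ : Set E3))] fun _ => (0 : ℝ) := by
    filter_upwards [hae, ae_restrict_mem (measurableSet_Iio.prod MeasurableSet.univ)]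
      with z hz hzm
    have hle : ‖uncurry v z‖ ≤ C / (‖z.2‖ + Real.sqrt (-z.1)) := by
      rw [← hz]
      exact hdec z.1 hzm.1 z.2
    exact max_eq_right (sub_nonpos.2 hle)
  have hEq := Measure.eqOn_open_of_ae_eq hf0 (isOpen_Iio.prod isOpen_univ) hfc continuousOn_const
  have h := hEq (x := (t, x)) ⟨ht, mem_univ _⟩
  simp only [uncurry_apply_pair] at h
  have h' := max_eq_right_iff.1 h
  linarith

/-- **Slices before time `0` determine ancient mild solutions.**  If `v' t = v t` for every `t < 0`
and `v` is an ancient mild solution, so is `v'`: every clause of `IsAncientMildSolution` evaluates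
slices at negative times only (the Duhamel integrals run over `[s, t] ⊆ (−∞, 0)`). [folklore] -/
private theorem satCE_isAncientMildSolution_congr {ν : ℝ} {v v' : ℝ → E3 → E3}
    (hv : IsAncientMildSolution ν v) (h : ∀ t < 0, v' t = v t) : IsAncientMildSolution ν v' := by
  refine ⟨fun t ht => ?_, fun s t hst ht => ?_⟩
  · rw [h t ht]; exact hv.1 t ht
  · intro φ hφ hφd
    have hs : s < 0 := hst.trans ht
    have hI : (∫ τ in s..t, ∫ x, ⟪v' τ x, convect (v' τ) (heatTest ν φ (t - τ)) x⟫) =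
        ∫ τ in s..t, ∫ x, ⟪v τ x, convect (v τ) (heatTest ν φ (t - τ)) x⟫ := by
      refine intervalIntegral.integral_congr fun τ hτ => ?_
      rw [uIcc_of_le hst.le] at hτ
      simp only [h τ (lt_of_le_of_lt hτ.2 ht)]
    rw [h t ht, h s hs, hI]
    exact hv.2 s t hst ht φ hφ hφd

/-- **The wall applied to the normalised representative.**  Let `v` be a Type-I ancient mild field
(`IsTypeIAncientMild C v`) which is pointwise `λ`-DSS on the open slab and obeys the apex bound
there, `1 < λ`, and assume `TypeIDSSLiouville λ`.  Then `v(t, ·) = 0` for every `t < 0`: the field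
`v' (t, x) = v(t, x)` for `t < 0`, `0` for `t ≥ 0`, is exactly `λ`-DSS, ancient mild with measurable
slices and the apex bound, so the wall makes its slices vanish a.e., hence identically (continuous
slices). [cite: BradshawTsai2017CPDE, §5 Open Problem 5.1] -/
private theorem satCE_wall_repr {C lam : ℝ} {v : ℝ → E3 → E3} (hv : IsTypeIAncientMild C v)
    (hpt : ∀ t < 0, ∀ x : E3, lam • v (lam ^ 2 * t) (lam • x) = v t x)
    (hdec : ∀ t < 0, ∀ x : E3, ‖v t x‖ ≤ C / (‖x‖ + Real.sqrt (-t)))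
    (hlam : 1 < lam) (hwall : TypeIDSSLiouville lam) : ∀ t < 0, ∀ x, v t x = 0 := by
  -- normalise `v` to `0` at times `t ≥ 0`
  obtain ⟨v', hv'⟩ : ∃ v' : ℝ → E3 → E3, v' = fun t x => if t < 0 then v t x else 0 := ⟨_, rfl⟩
  have hslice : ∀ t < 0, v' t = v t := fun t ht => by
    funext x; rw [hv']; dsimp only; rw [if_pos ht]
  have hmild : IsAncientMildSolution 1 v' :=
    satCE_isAncientMildSolution_congr hv.isAncientMildSolution hslice
  have hmeas : ∀ t < 0, AEStronglyMeasurable (v' t) volume := fun t ht => by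
    rw [hslice t ht]; exact hv.aestronglyMeasurable_slice ht
  have hdss : IsDiscretelySelfSimilar lam v' := by
    show nsRescale lam v' = v'
    funext t x
    rw [nsRescale_apply]
    by_cases ht : t < 0
    · have hlt : lam ^ 2 * t < 0 := mul_neg_of_pos_of_neg (by positivity) ht
      rw [hslice t ht, hslice _ hlt]
      exact hpt t ht x
    · have hge : ¬ lam ^ 2 * t < 0 := not_lt.2 (mul_nonneg (by positivity) (not_lt.1 ht))
      rw [hv']; dsimp only; rw [if_neg ht, if_neg hge, smul_zero]
  have hdec' : HasTypeIDecay C v' := fun t ht x => by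
    rw [hslice t ht]; exact hdec t ht x
  have h0 : ∀ t < 0, v' t =ᵐ[volume] 0 := hwall hlam v' hmild hmeas hdss ⟨C, hdec'⟩
  intro t ht x
  have h1 : v t =ᵐ[volume] 0 := by rw [← hslice t ht]; exact h0 t ht
  have h2 : v t = 0 :=
    (Continuous.ae_eq_iff_eq volume (hv.continuous_slice ht) continuous_const).1 h1
  exact congrFun h2 x

/-- **(c) THE PERIODIC RUNG INSIDE THE CLASS.**  An a.e. `λ`-DSS (`λ > 1`) suitable weak solution
on `ℝ₋ × ℝ³` with a weak gradient, `𝐈(ℝ³ × ℝ₋) < ∞` and the apex bound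
`‖u(t, x)‖ ≤ C/(‖x‖ + √(−t))` is regular at the origin if `TypeIDSSLiouville λ` holds: continuous
Oseen-mild representative (Albritton–Barker Thm 1.1, KNSS Prop. 4.1), made exactly DSS, with the
apex bound and measurable slices; the wall kills it, so `u = 0` a.e. on the slab.
[cite: AlbrittonBarker2019, Thm 1.1] [cite: KochNadirashviliSereginSverak2009, Prop. 4.1]
[cite: BradshawTsai2017CPDE, §5 Open Problem 5.1] -/
private theorem satCE_periodicRung :
    ∀ (u : ℝ → EuclideanSpace ℝ (Fin 3) → EuclideanSpace ℝ (Fin 3))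
      (p : ℝ → EuclideanSpace ℝ (Fin 3) → ℝ)
      (G : ℝ → EuclideanSpace ℝ (Fin 3) → EuclideanSpace ℝ (Fin 3) →L[ℝ] EuclideanSpace ℝ (Fin 3))
      (C lam : ℝ),
      IsSuitableWeakSolutionOn (slab (EuclideanSpace ℝ (Fin 3)) (Iio 0) isOpen_Iio) 1 0 u p →
      HasWeakSpatialGradientOn (slab (EuclideanSpace ℝ (Fin 3)) (Iio 0) isOpen_Iio) u G →
      typeIBound (Iio (0 : ℝ) ×ˢ univ) u p G < ⊤ → HasTypeIDecay C u → 1 < lam →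
      (∀ᵐ z ∂(volume.restrict (Iio (0 : ℝ) ×ˢ (univ : Set (EuclideanSpace ℝ (Fin 3))))),
        nsRescale lam u z.1 z.2 = u z.1 z.2) →
      TypeIDSSLiouville lam → ¬ IsBackwardSingularPoint u 0 := by
  intro u p G C lam hsw _hwg hI hdec hlam hdss hwall
  -- the apex bound gives the rate, with `0 ≤ C`
  have hC0 : 0 ≤ C := by
    have h := hdec (-1) (by norm_num) 0
    rw [norm_zero, zero_add, neg_neg, Real.sqrt_one, div_one] at h
    exact (norm_nonneg _).trans h
  -- continuous Oseen-mild representative, a Type-I ancient mild field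
  obtain ⟨v, hae, hcont, hdiv, hmild, hrate⟩ :=
    exists_oseenMild_repr_of_typeIBound_lt_top hsw (hdec.hasTypeITimeDecay hC0) hI
  have hTI : IsTypeIAncientMild C v := isTypeIAncientMild_of_continuous_oseenMild hcont hdiv hmild hrate
  -- pointwise DSS and the apex bound for `v`
  have hpt : ∀ t < 0, ∀ x : E3, lam • v (lam ^ 2 * t) (lam • x) = v t x := fun t ht x =>
    satCE_dss_pointwise hae hcont (zero_lt_one.trans hlam) hdss ht x
  have hdecv : ∀ t < 0, ∀ x : E3, ‖v t x‖ ≤ C / (‖x‖ + Real.sqrt (-t)) := fun t ht x =>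
    satCE_decay_repr hae hcont hdec ht x
  -- the wall kills `v`, hence `u = 0` a.e. on the slab
  have hv0 := satCE_wall_repr hTI hpt hdecv hlam hwall
  refine satCE_not_singular_of_ae_zero_slab ?_
  filter_upwards [hae, ae_restrict_mem (measurableSet_Iio.prod MeasurableSet.univ)] with z hz hzm
  rw [hz, Pi.zero_apply]
  exact hv0 z.1 hzm.1 z.2

/-! ## S4 — closing endpoints (card pesin-closing-hyperbolic-hulls) -/

/-- **S4, closing endpoints** (conjunction of three lemmas).
(a) ACCUMULATION KILL: if rotated-DSS ancient mild fields with the apex bound accumulate at a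
jointly measurable `u` in `L³(K)` for every compact `K ⊆ {t ≤ 0} × ℝ³`, the rotated Type-I DSS
wall makes `u = 0` a.e. near the origin, hence regular.  (b) RELATIVE-PERIODIC KILL: a rotated-DSS ancient mild
field with the apex bound is regular at the origin under the wall.  (c) THE PERIODIC RUNG
INSIDE THE CLASS: an a.e. `λ`-DSS (`λ > 1`) member of the class with the apex bound is regular
at the origin if `TypeIDSSLiouville λ` holds (continuous Oseen-mild representative, made
exactly DSS, measurable slices).
[cite: BradshawTsai2017CPDE, §5 Open Problem 5.1] [cite: ChaeWolf2017, Def. 1.1]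
[cite: AlbrittonBarker2019, Thm 1.1] [cite: KochNadirashviliSereginSverak2009, Prop. 4.1] -/
theorem stub_satClosingEndpoints :
    (∀ (u : ℝ → EuclideanSpace ℝ (Fin 3) → EuclideanSpace ℝ (Fin 3)),
      AEStronglyMeasurable (uncurry u) (volume.restrict (Iio (0 : ℝ) ×ˢ univ)) →
      (∀ ε : ℝ, 0 < ε → ∀ K : Set (ℝ × EuclideanSpace ℝ (Fin 3)), IsCompact K →
        K ⊆ Iic (0 : ℝ) ×ˢ univ →
        ∃ (c : ℝ) (R : EuclideanSpace ℝ (Fin 3) ≃ₗᵢ[ℝ] EuclideanSpace ℝ (Fin 3))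
          (w : ℝ → EuclideanSpace ℝ (Fin 3) → EuclideanSpace ℝ (Fin 3)) (C₀ : ℝ), 1 < c ∧
          IsAncientMildSolution 1 w ∧ (∀ t < 0, AEStronglyMeasurable (w t) volume) ∧
          AEStronglyMeasurable (uncurry w) (volume.restrict (Iio (0 : ℝ) ×ˢ univ)) ∧
          IsRotatedDSS c R w ∧ HasTypeIDecay C₀ w ∧
          eLpNorm (fun z : ℝ × EuclideanSpace ℝ (Fin 3) => w z.1 z.2 - u z.1 z.2) 3
            (volume.restrict K) ≤ ENNReal.ofReal ε) →
      (∀ (c : ℝ) (R : EuclideanSpace ℝ (Fin 3) ≃ₗᵢ[ℝ] EuclideanSpace ℝ (Fin 3)),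
        RotatedTypeIDSSLiouville c R) →
      ¬ IsBackwardSingularPoint u 0) ∧
    (∀ (u : ℝ → EuclideanSpace ℝ (Fin 3) → EuclideanSpace ℝ (Fin 3)),
      IsAncientMildSolution 1 u → (∀ t < 0, AEStronglyMeasurable (u t) volume) →
      AEStronglyMeasurable (uncurry u) (volume.restrict (Iio (0 : ℝ) ×ˢ univ)) →
      (∃ C₀ : ℝ, HasTypeIDecay C₀ u) →
      (∃ (c : ℝ) (R : EuclideanSpace ℝ (Fin 3) ≃ₗᵢ[ℝ] EuclideanSpace ℝ (Fin 3)), 1 < c ∧ IsRotatedDSS c R u) →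
      (∀ (c : ℝ) (R : EuclideanSpace ℝ (Fin 3) ≃ₗᵢ[ℝ] EuclideanSpace ℝ (Fin 3)),
        RotatedTypeIDSSLiouville c R) →
      ¬ IsBackwardSingularPoint u 0) ∧
    (∀ (u : ℝ → EuclideanSpace ℝ (Fin 3) → EuclideanSpace ℝ (Fin 3))
      (p : ℝ → EuclideanSpace ℝ (Fin 3) → ℝ)
      (G : ℝ → EuclideanSpace ℝ (Fin 3) → EuclideanSpace ℝ (Fin 3) →L[ℝ] EuclideanSpace ℝ (Fin 3))
      (C lam : ℝ),
      IsSuitableWeakSolutionOn (slab (EuclideanSpace ℝ (Fin 3)) (Iio 0) isOpen_Iio) 1 0 u p →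
      HasWeakSpatialGradientOn (slab (EuclideanSpace ℝ (Fin 3)) (Iio 0) isOpen_Iio) u G →
      typeIBound (Iio (0 : ℝ) ×ˢ univ) u p G < ⊤ → HasTypeIDecay C u → 1 < lam →
      (∀ᵐ z ∂(volume.restrict (Iio (0 : ℝ) ×ˢ (univ : Set (EuclideanSpace ℝ (Fin 3))))),
        nsRescale lam u z.1 z.2 = u z.1 z.2) →
      TypeIDSSLiouville lam → ¬ IsBackwardSingularPoint u 0) :=
  ⟨satCE_accumulation, satCE_relPeriodic, satCE_periodicRung⟩

end Summit.NavierStokesRegularity.NavierStokesRegularity.Theorems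

end
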